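import Literature.NumberTheory.Sieve.GoldstonPintzYildirimEulerProduct
import Literature.NumberTheory.LFunctions.ZetaClassicalRegionBounds
import Literature.NumberTheory.LFunctions.MertensBoundRH
import Literature.Analysis.Complex.RectangleCauchyFormula
import Literature.Analysis.Complex.VerticalLineIntegrals
import HarnessLib

/-!
# Goldston–Pintz–Yıldırım, *Primes in tuples I*, §6 (6.17)–(6.18) and (6.2): the contour shift

Trunk: NumberTheory / Sieve; the last step of GPY §6 ("A special case of Proposition 1"), after
`GoldstonPintzYildirimCounting` ((6.3)–(6.5): `S_R(N;H) = N T_R(N;H) + O(R (k + log R)^{2k})`),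
`GoldstonPintzYildirimMellin` ((6.7): `T_R = (1/2πi)∫_(1) F(s) R^s s^{−k−1} ds`) and
`GoldstonPintzYildirimEulerProduct` ((6.7)–(6.10), (6.13)–(6.16): `F = G_H ζ(1+s)^{−k}`, `G_H`
holomorphic on `σ > −1/2`, `G_H(0) = 𝔖(H)`, `|G_H(s)| ≤ exp(kU^δ(4 log log U + 25))`), with the
zero-free region input (5.3)–(5.4) of `ZetaClassicalRegionBounds`
(`Literature.NumberTheory.LFunctions.ZetaClassicalRegion.exists_zeroFreeRegion_bounds`: `ζ(w) ≠ 0`, `1/ζ(w) ≪ log(|t|+3)` for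
`Re w ≥ 1 − 4c̄/log(|t|+3)`). GPY, *Primes in tuples. I*, Ann. of Math. 170 (2009) =
arXiv:math/0508185, §6, p. 13:

> Returning to the integral in (6.7), we see that the integrand vanishes as `|t| → ∞`,
> `−1/4 < σ ≤ 1`. By (6.9) we see that in moving the contour from `(1)` to the left to `ℒ` we
> either pass through a simple pole at `s = 0` when `H` is admissible (so that `𝔖(H) ≠ 0`), or we
> pass through a regular point at `s = 0` when `H` is not admissible. In either case, we have by
> (5.2), (6.11), (6.14), (6.17), and Lemma 1, for any `k` satisfying (6.1),
> `T_R(N; H) = G_H(0) + (1/2πi)∫_ℒ F(s) R^s s^{−(k+1)} ds = 𝔖(H) + O(e^{−c√log R})`.   (6.18)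
> Equation (6.2) now follows from this and (6.5).

Everything here is PROVED (theorems only):

* `integral_integrand_line_eq` — the line `(1)` of (6.7) may be moved to `σ = σ₁` for any
  `0 < σ₁ ≤ 1` (no poles; `Literature.NumberTheory.LFunctions.MertensBoundRH.integral_vertical_eq_of_tendsto`);
* `rect_integral_eq` — Cauchy's formula on `[−σ₀, σ₁] × [−T, T]` inside the region (5.2): the
  integrand `F(s)R^s s^{−k−1} = g(s)/s`, `g(s) = G_H(s) R^s W(s)^{−k}`, `W(s) = sζ(1+s)` entire
  ((7.14); Mathlib's `riemannZeta₁ (1+s)`), has a simple pole at `0` with residue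
  `g(0) = G_H(0) = 𝔖(H)` ((6.9)–(6.10));
* `abs_mainTR_sub_singularSeries_le` — **(6.17)–(6.18) with explicit constants**: for `R ≥ e⁴`,
  `|T_R(N;H) − 𝔖(H)| ≤ 6 exp(kU^{c̄/√L}(4 log log U + 25)) ((2 + C/c̄ + C)L)^k e^{−c̄√L}`,
  `L = log R`, with the polygonal contour `σ = 1/L` (`|t| ≥ T`), `t = ±T`, `σ = −c̄/√L`
  (`|t| ≤ T`), `T = e^{√L} − 3`, in place of GPY's curve `ℒ` (so Lemma 1 is not needed: on the
  left edge `|R^s| = e^{−c̄√L}` identically, the tails and horizontal edges are `O(e^{−√L})`);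
* `exists_abs_mainTR_sub_singularSeries_le` — **(6.18)** for fixed `k`: `∀ k ≥ 1, C₀ > 0`,
  `∃ c > 0, R₀`, for `R ≥ R₀` and every `k`-set `H ⊆ [0, h]`, `h ≤ R^{C₀}`:
  `|T_R − 𝔖(H)| ≤ e^{−c√log R}`;
* `exists_abs_sum_lambdaR_sub_le` — **(6.2)** for fixed `k`:
  `|∑_{n ≤ N} Λ_R(n; H) − 𝔖(H)N| ≤ N e^{−c√log R} + R(2 log R)^{2k}`.

What is NOT tracked: the uniformity in `k ≪ (log R)^{1/2−η₀}` of (6.1) (our `c`, `R₀` depend on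
`k`), which GPY need only for (1.9).

## References

* D. A. Goldston, J. Pintz, C. Y. Yıldırım, *Primes in tuples. I*, Ann. of Math. (2) 170 (2009),
  819–862 = arXiv:math/0508185, §5 (5.2)–(5.5), §6 (6.2), (6.11)–(6.12), (6.17)–(6.18), §7 (7.14),
  pp. 10–13. [cite: GoldstonPintzYildirim2009]
* E. C. Titchmarsh, *The Theory of the Riemann Zeta-Function*, 2nd ed. (1986), Thm 3.11 and
  (3.11.8) (the bounds (5.3)–(5.4)). [cite: Titchmarsh1986]
-/

noncomputable section

open Finset Complex Filter Topology MeasureTheory Set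
open scoped ArithmeticFunction.Moebius ArithmeticFunction.omega

namespace Literature.NumberTheory.Sieve.GPY

open Literature.Analysis.Complex (perronPow)

/-! #### `ζ(1+s)`, `W(s) = s ζ(1+s)` -/

/-- `ζ(1 + s) ≠ 0` for `Re s > 0`. [folklore] -/
theorem riemannZeta_one_add_ne_zero {s : ℂ} (hs : 0 < s.re) : riemannZeta (1 + s) ≠ 0 :=
  riemannZeta_ne_zero_of_one_lt_re (by simp only [add_re, one_re]; linarith)

/-- `s ↦ ζ(1 + s)` is differentiable at `s ≠ 0`. [folklore] -/
theorem differentiableAt_riemannZeta_one_add {s : ℂ} (hs : s ≠ 0) :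
    DifferentiableAt ℂ (fun z : ℂ => riemannZeta (1 + z)) s := by
  have h1 : (1 + s) ≠ 1 := fun h => hs (by linear_combination h)
  exact (differentiableAt_riemannZeta h1).comp s ((differentiableAt_id).const_add 1)

/-- `‖1/ζ(1+s)‖ ≤ (1 + σ)/σ` for `σ = Re s > 0`. [cite: Titchmarsh1986, §1.1 eq. (1.1.4)] -/
theorem norm_inv_riemannZeta_one_add_le {s : ℂ} (hs : 0 < s.re) :
    ‖(riemannZeta (1 + s))⁻¹‖ ≤ (1 + s.re) / s.re := by
  have h := Literature.NumberTheory.LFunctions.ZetaClassicalRegion.norm_inv_riemannZeta_le_of_one_lt_re (s := 1 + s)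
    (by simp only [add_re, one_re]; linarith)
  simpa only [add_re, one_re, add_sub_cancel_left] using h

/-- `W(s) = riemannZeta₁ (1 + s) = s ζ(1+s)` for `s ≠ 0` (`W(0) = 1`): the entire function of
GPY (7.14). [cite: GoldstonPintzYildirim2009, Section 7 eq. 7.14] -/
theorem riemannZeta₁_one_add {s : ℂ} (hs : s ≠ 0) :
    riemannZeta₁ (1 + s) = s * riemannZeta (1 + s) := by
  have h1 : (1 + s) ≠ 1 := fun h => hs (by linear_combination h)
  rw [Literature.NumberTheory.LFunctions.riemannZeta₁_eq_mul h1, add_sub_cancel_left]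

/-- `W` is entire. [folklore] -/
theorem differentiable_riemannZeta₁_one_add :
    Differentiable ℂ (fun z : ℂ => riemannZeta₁ (1 + z)) :=
  differentiable_riemannZeta₁.comp ((differentiable_id).const_add 1)

/-! #### The zero-free region input (5.4) transported to `ζ(1+s)` -/

/-- In the region `σ ≥ −4c̄/log(|t|+3)`, `s ≠ 0`: `ζ(1+s) ≠ 0` and `|1/ζ(1+s)| ≤ C log(|t|+3)`.
[cite: GoldstonPintzYildirim2009, Section 5 eq. 5.4] -/
theorem zfr_one_add {cbar C : ℝ}
    (hP : ∀ s : ℂ, s ≠ 1 → 1 - 4 * cbar / Real.log (|s.im| + 3) ≤ s.re →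
      riemannZeta s ≠ 0 ∧ ‖(riemannZeta s)⁻¹‖ ≤ C * Real.log (|s.im| + 3))
    {s : ℂ} (hs : s ≠ 0)
    (hσ : -(4 * cbar / Real.log (|s.im| + 3)) ≤ s.re) :
    riemannZeta (1 + s) ≠ 0 ∧ ‖(riemannZeta (1 + s))⁻¹‖ ≤ C * Real.log (|s.im| + 3) := by
  have h1 : (1 + s) ≠ 1 := fun h => hs (by linear_combination h)
  have h := hP (1 + s) h1 (by simp only [add_re, one_re, add_im, one_im, zero_add]; linarith)
  simp only [add_im, one_im, zero_add] at h
  exact h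

/-- The rectangle `σ ≥ −c̄/log(T+3)`, `|t| ≤ T` lies in the region `σ ≥ −4c̄/log(|t|+3)`.
[cite: GoldstonPintzYildirim2009, Section 5 eq. 5.5] -/
theorem region_of_rect {cbar : ℝ} (hc : 0 ≤ cbar) {T σ t : ℝ} (ht : |t| ≤ T)
    (hσ : -(cbar / Real.log (T + 3)) ≤ σ) :
    -(4 * cbar / Real.log (|t| + 3)) ≤ σ := by
  have hL1 : 1 < Real.log (|t| + 3) := Literature.NumberTheory.LFunctions.ZetaClassicalRegion.one_lt_log_abs_add_three t
  have hL0 : 0 < Real.log (|t| + 3) := by linarith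
  have hLT : Real.log (|t| + 3) ≤ Real.log (T + 3) :=
    Real.log_le_log (by positivity) (by linarith)
  have hT0 : 0 < Real.log (T + 3) := by linarith
  have h1 : cbar / Real.log (T + 3) ≤ cbar / Real.log (|t| + 3) :=
    div_le_div_of_nonneg_left hc hL0 hLT
  have h2 : cbar / Real.log (|t| + 3) ≤ 4 * cbar / Real.log (|t| + 3) :=
    div_le_div_of_nonneg_right (by linarith) hL0.le
  linarith

/-! #### Norm of the integrand -/

/-- `‖G/ζ(1+s)^k · P‖ = ‖G‖ ‖ζ(1+s)⁻¹‖^k ‖P‖`. [folklore] -/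
theorem norm_div_pow_mul (G Z P : ℂ) (k : ℕ) :
    ‖G / Z ^ k * P‖ = ‖G‖ * ‖Z⁻¹‖ ^ k * ‖P‖ := by
  rw [norm_mul, norm_div, norm_pow, norm_inv, div_eq_mul_inv, inv_pow]

/-- Monotonicity of the bound (6.16) in `δ`: for `U ≥ 16`, `0 ≤ δ ≤ δ'`,
`exp(k U^δ (4 log log U + 25)) ≤ exp(k U^{δ'} (4 log log U + 25))`. [folklore] -/
theorem exp_gpyU_bound_mono (k h : ℕ) {δ δ' : ℝ} (hδ : δ ≤ δ') :
    Real.exp (k * gpyU k h ^ δ * (4 * Real.log (Real.log (gpyU k h)) + 25)) ≤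
      Real.exp (k * gpyU k h ^ δ' * (4 * Real.log (Real.log (gpyU k h)) + 25)) := by
  have hU := sixteen_le_gpyU k h
  have hlog : 1 < Real.log (gpyU k h) := by
    rw [Real.lt_log_iff_exp_lt (gpyU_pos k h)]
    exact lt_of_lt_of_le (lt_of_lt_of_le Real.exp_one_lt_d9 (by norm_num)) hU
  have hll : 0 < Real.log (Real.log (gpyU k h)) := Real.log_pos hlog
  have hpos : 0 < 4 * Real.log (Real.log (gpyU k h)) + 25 := by linarith
  refine Real.exp_le_exp.2 (mul_le_mul_of_nonneg_right (mul_le_mul_of_nonneg_left ?_ (Nat.cast_nonneg k)) hpos.le)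
  exact Real.rpow_le_rpow_of_exponent_le (by linarith) hδ

/-! #### Tails of a line integral -/

/-- If `‖g(t)‖ ≤ M/t²` for `|t| ≥ T > 0` and `g` is integrable, then
`‖∫_ℝ g − ∫_{−T}^{T} g‖ ≤ 2M/T`. [folklore] -/
theorem norm_integral_sub_intervalIntegral_le {g : ℝ → ℂ} (hg : Integrable g) {T M : ℝ}
    (hT : 0 < T) (hM : ∀ t : ℝ, T ≤ |t| → ‖g t‖ ≤ M / t ^ 2) :
    ‖(∫ t, g t) - ∫ t in (-T)..T, g t‖ ≤ 2 * (M / T) := by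
  have h1 := intervalIntegral.integral_Iic_add_Ioi (hg.integrableOn (s := Iic (-T)))
    (hg.integrableOn (s := Ioi (-T)))
  have h2 := intervalIntegral.integral_interval_add_Ioi (a := -T) (b := T)
    (hg.integrableOn (s := Ioi (-T))) (hg.integrableOn (s := Ioi T))
  have hsplit : (∫ t, g t) - ∫ t in (-T)..T, g t = (∫ t in Iic (-T), g t) + ∫ t in Ioi T, g t := by
    rw [← h1, ← h2]; ring
  -- the majorant `M/t²` on `(T, ∞)`
  have hmaj_int : IntegrableOn (fun t : ℝ => M * t ^ (-2 : ℝ)) (Ioi T) :=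
    ((integrableOn_Ioi_rpow_of_lt (by norm_num) hT).const_mul M)
  have hmaj_val : ∫ t in Ioi T, M * t ^ (-2 : ℝ) = M / T := by
    rw [integral_const_mul, integral_Ioi_rpow_of_lt (by norm_num) hT]
    have : (-2 : ℝ) + 1 = -1 := by norm_num
    rw [this, Real.rpow_neg_one]
    field_simp
  have hM' : ∀ t : ℝ, T < t → M / t ^ 2 = M * t ^ (-2 : ℝ) := fun t ht => by
    have ht0 : 0 < t := hT.trans ht
    rw [Real.rpow_neg ht0.le, Real.rpow_two, div_eq_mul_inv]
  have hright : ‖∫ t in Ioi T, g t‖ ≤ M / T := by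
    rw [← hmaj_val]
    refine norm_integral_le_of_norm_le hmaj_int ?_
    rw [ae_restrict_iff' measurableSet_Ioi]
    refine Eventually.of_forall fun t ht => ?_
    have ht' : T < t := ht
    rw [← hM' t ht']
    exact hM t (by rw [abs_of_pos (hT.trans ht')]; exact ht'.le)
  have hleft : ‖∫ t in Iic (-T), g t‖ ≤ M / T := by
    rw [← integral_comp_neg_Ioi, ← hmaj_val]
    refine norm_integral_le_of_norm_le hmaj_int ?_
    rw [ae_restrict_iff' measurableSet_Ioi]
    refine Eventually.of_forall fun t ht => ?_
    have ht' : T < t := ht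
    rw [← hM' t ht']
    have := hM (-t) (by rw [abs_neg, abs_of_pos (hT.trans ht')]; exact ht'.le)
    simpa using this
  rw [hsplit]
  calc ‖(∫ t in Iic (-T), g t) + ∫ t in Ioi T, g t‖
      ≤ ‖∫ t in Iic (-T), g t‖ + ‖∫ t in Ioi T, g t‖ := norm_add_le _ _
    _ ≤ M / T + M / T := add_le_add hleft hright
    _ = 2 * (M / T) := by ring

/-! #### The Poisson-kernel integral for the left edge -/

/-- `∫_ℝ dt/(σ² + t²) = π/σ` for `σ > 0`. [folklore] -/
theorem integral_inv_sq_add_sq {σ : ℝ} (hσ : 0 < σ) :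
    ∫ t : ℝ, (σ ^ 2 + t ^ 2)⁻¹ = Real.pi / σ := by
  have h : (fun t : ℝ => (σ ^ 2 + t ^ 2)⁻¹) = fun t : ℝ => (σ ^ 2)⁻¹ * (1 + (t / σ) ^ 2)⁻¹ := by
    funext t
    rw [← mul_inv, mul_add, mul_one, div_pow, mul_div_cancel₀ _ (pow_ne_zero 2 hσ.ne')]
  rw [h, integral_const_mul, Measure.integral_comp_div (fun t : ℝ => (1 + t ^ 2)⁻¹) σ,
    integral_univ_inv_one_add_sq, abs_of_pos hσ, smul_eq_mul]
  field_simp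

/-- The majorant `(σ² + t²)⁻¹` is integrable. [folklore] -/
theorem integrable_inv_sq_add_sq {σ : ℝ} (hσ : 0 < σ) :
    Integrable fun t : ℝ => (σ ^ 2 + t ^ 2)⁻¹ := by
  have h : (fun t : ℝ => (σ ^ 2 + t ^ 2)⁻¹) = fun t : ℝ => (σ ^ 2)⁻¹ * (1 + (t / σ) ^ 2)⁻¹ := by
    funext t
    rw [← mul_inv, mul_add, mul_one, div_pow, mul_div_cancel₀ _ (pow_ne_zero 2 hσ.ne')]
  rw [h]
  exact (integrable_inv_one_add_sq.comp_div hσ.ne').const_mul _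

/-- For `σ ≠ 0`, `k ≥ 1`: `‖σ + it‖^{-(k+1)} ≤ |σ|^{-(k-1)} (σ² + t²)⁻¹`. [folklore] -/
theorem inv_norm_pow_le {σ : ℝ} (hσ : σ ≠ 0) {k : ℕ} (hk : 1 ≤ k) (t : ℝ) :
    (‖(σ : ℂ) + t * I‖ ^ (k + 1))⁻¹ ≤ (|σ| ^ (k - 1))⁻¹ * (σ ^ 2 + t ^ 2)⁻¹ := by
  set n : ℝ := ‖(σ : ℂ) + t * I‖ with hn
  have hnsq : n ^ 2 = σ ^ 2 + t ^ 2 := by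
    rw [hn, Complex.sq_norm, Complex.normSq_apply]; simp; ring
  have hσn : |σ| ≤ n := Literature.Analysis.Complex.abs_re_le_norm_line σ t
  have hσa : 0 < |σ| := abs_pos.2 hσ
  have hn0 : 0 < n := hσa.trans_le hσn
  obtain ⟨j, rfl⟩ : ∃ j, k = j + 1 := ⟨k - 1, by omega⟩
  simp only [add_tsub_cancel_right]
  rw [← mul_inv, ← hnsq, show j + 1 + 1 = j + 2 by ring, pow_add]
  refine inv_anti₀ (by positivity) ?_
  exact mul_le_mul_of_nonneg_right (pow_le_pow_left₀ hσa.le hσn j) (by positivity)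

/-! #### The continued integrand `f(s) = G_H(s) ζ(1+s)^{−k} R^s s^{−k−1}` right of `σ = 0` -/

/-- The bound (6.16) at `δ = 0`: `B₀ = exp(k (4 log log U + 25))` bounds `G_H` on `Re s ≥ 0`.
[cite: GoldstonPintzYildirim2009, Section 6 eq. 6.16] -/
theorem norm_GH_le_of_re_nonneg {H : Finset ℕ} (hH : H.Nonempty) {h : ℕ} (hh : ∀ x ∈ H, x ≤ h)
    {s : ℂ} (hs : 0 ≤ s.re) :
    ‖GH H s‖ ≤ Real.exp (#H * (4 * Real.log (Real.log (gpyU #H h)) + 25)) := by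
  have h1 := norm_GH_le hH hh (by linarith : -1 / 4 ≤ s.re)
  rwa [max_eq_right (by linarith : -s.re ≤ 0), Real.rpow_zero, mul_one] at h1

/-- `f` is differentiable at every `s` with `Re s > 0`. [folklore] -/
theorem differentiableAt_integrand {R : ℝ} (hR : 0 < R) {H : Finset ℕ} (hH : H.Nonempty) {s : ℂ}
    (hs : 0 < s.re) :
    DifferentiableAt ℂ (fun z : ℂ => GH H z / riemannZeta (1 + z) ^ #H * perronPow R #H z) s := by
  have hs0 : s ≠ 0 := fun h => by rw [h] at hs; simp at hs
  have hG : DifferentiableAt ℂ (GH H) s :=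
    (differentiableOn_GH hH).differentiableAt
      ((isOpen_lt continuous_const Complex.continuous_re).mem_nhds
        (by show -1 / 2 < s.re; linarith))
  exact (hG.div ((differentiableAt_riemannZeta_one_add hs0).pow _)
    (pow_ne_zero _ (riemannZeta_one_add_ne_zero hs))).mul
      (Literature.Analysis.Complex.differentiableAt_perronPow hR _ hs0)

/-- `f` is differentiable on the open half-plane `Re s > 0`, a fortiori on every closed strip
`[a, b] × ℝ` with `a > 0`. [folklore] -/
theorem differentiableOn_integrand_strip {R : ℝ} (hR : 0 < R) {H : Finset ℕ} (hH : H.Nonempty)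
    {a b : ℝ} (ha : 0 < a) :
    DifferentiableOn ℂ (fun z : ℂ => GH H z / riemannZeta (1 + z) ^ #H * perronPow R #H z)
      (Icc a b ×ℂ univ) := fun _ hs =>
  (differentiableAt_integrand hR hH (ha.trans_le (mem_reProdIm.1 hs).1.1)).differentiableWithinAt

/-- `t ↦ f(σ + it)` is continuous for `σ > 0`. [folklore] -/
theorem continuous_integrand_vertical {R : ℝ} (hR : 0 < R) {H : Finset ℕ} (hH : H.Nonempty)
    {σ : ℝ} (hσ : 0 < σ) :
    Continuous fun t : ℝ =>
      GH H (σ + t * I) / riemannZeta (1 + (σ + t * I)) ^ #H * perronPow R #H (σ + t * I) := by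
  refine continuous_iff_continuousAt.2 fun t => ?_
  have hd := differentiableAt_integrand hR hH (s := (σ : ℂ) + t * I) (by simpa using hσ)
  exact hd.continuousAt.comp (f := fun t : ℝ => (σ : ℂ) + t * I) (by fun_prop)

/-- Pointwise bound on the line `Re s = σ > 0`:
`‖f(σ+it)‖ ≤ B₀ ((1+σ)/σ)^k ‖R^s s^{−k−1}‖`. [folklore] -/
theorem norm_integrand_le_of_re_pos (R : ℝ) {H : Finset ℕ} (hH : H.Nonempty)
    {h : ℕ} (hh : ∀ x ∈ H, x ≤ h) {σ : ℝ} (hσ : 0 < σ) (t : ℝ) :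
    ‖GH H (σ + t * I) / riemannZeta (1 + (σ + t * I)) ^ #H * perronPow R #H (σ + t * I)‖ ≤
      Real.exp (#H * (4 * Real.log (Real.log (gpyU #H h)) + 25)) * ((1 + σ) / σ) ^ #H *
        ‖perronPow R #H (σ + t * I)‖ := by
  rw [norm_div_pow_mul]
  have hs : (0 : ℝ) < ((σ : ℂ) + t * I).re := by simpa using hσ
  have h1 := norm_GH_le_of_re_nonneg hH hh hs.le
  have h2 : ‖(riemannZeta (1 + (σ + t * I)))⁻¹‖ ≤ (1 + σ) / σ := by
    have := norm_inv_riemannZeta_one_add_le hs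
    simpa using this
  gcongr

/-- `f` is integrable on the line `Re s = σ > 0` (`k ≥ 1`). [folklore] -/
theorem integrable_integrand_vertical {R : ℝ} (hR : 0 < R) {H : Finset ℕ} (hH : H.Nonempty)
    {h : ℕ} (hh : ∀ x ∈ H, x ≤ h) {σ : ℝ} (hσ : 0 < σ) :
    Integrable fun t : ℝ =>
      GH H (σ + t * I) / riemannZeta (1 + (σ + t * I)) ^ #H * perronPow R #H (σ + t * I) := by
  have hk : 1 ≤ #H := hH.card_pos
  refine Integrable.mono'
    (((Literature.Analysis.Complex.integrable_perronPow_vertical hR hk hσ.ne').norm).const_mul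
      (Real.exp (#H * (4 * Real.log (Real.log (gpyU #H h)) + 25)) * ((1 + σ) / σ) ^ #H))
    (continuous_integrand_vertical hR hH hσ).aestronglyMeasurable
    (Eventually.of_forall fun t => ?_)
  exact norm_integrand_le_of_re_pos R hH hh hσ t

/-- Uniform decay in the strip `σ₁ ≤ Re s ≤ 1` (`σ₁ > 0`): `‖f(σ + iT)‖ ≤ C/|T|` for `|T| ≥ 1`.
[folklore] -/
theorem norm_integrand_le_div {R : ℝ} (hR : 1 ≤ R) {H : Finset ℕ} (hH : H.Nonempty)
    {h : ℕ} (hh : ∀ x ∈ H, x ≤ h) {σ₁ : ℝ} (hσ₁ : 0 < σ₁) :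
    ∀ σ ∈ Icc σ₁ 1, ∀ T : ℝ, 1 ≤ |T| →
      ‖GH H (σ + T * I) / riemannZeta (1 + (σ + T * I)) ^ #H * perronPow R #H (σ + T * I)‖ ≤
        Real.exp (#H * (4 * Real.log (Real.log (gpyU #H h)) + 25)) * ((1 + σ₁) / σ₁) ^ #H * R /
          |T| := by
  intro σ hσ T hT
  have hσ0 : 0 < σ := hσ₁.trans_le hσ.1
  have hR0 : 0 < R := by linarith
  refine (norm_integrand_le_of_re_pos R hH hh hσ0 T).trans ?_
  have hB : 0 ≤ Real.exp (#H * (4 * Real.log (Real.log (gpyU #H h)) + 25)) := (Real.exp_pos _).le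
  have hratio : (1 + σ) / σ ≤ (1 + σ₁) / σ₁ := by
    rw [div_le_div_iff₀ hσ0 hσ₁]; nlinarith [hσ.1]
  have hratio0 : 0 ≤ (1 + σ) / σ := by positivity
  have hP : ‖perronPow R #H (σ + T * I)‖ ≤ R / |T| := by
    have hTne : T ≠ 0 := by intro h0; rw [h0, abs_zero] at hT; linarith
    refine (Literature.Analysis.Complex.norm_perronPow_le_horizontal hR0 #H σ hTne).trans ?_
    · have hT0 : 0 < |T| := by linarith
      have h1 : R ^ σ ≤ R := by
        calc R ^ σ ≤ R ^ (1 : ℝ) := Real.rpow_le_rpow_of_exponent_le hR hσ.2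
          _ = R := Real.rpow_one R
      have h2 : |T| ≤ |T| ^ (#H + 1) := by
        calc |T| = |T| ^ 1 := (pow_one _).symm
          _ ≤ |T| ^ (#H + 1) := pow_le_pow_right₀ hT (by omega)
      exact div_le_div₀ hR0.le h1 hT0 h2
  calc Real.exp (#H * (4 * Real.log (Real.log (gpyU #H h)) + 25)) * ((1 + σ) / σ) ^ #H *
        ‖perronPow R #H (σ + T * I)‖
      ≤ Real.exp (#H * (4 * Real.log (Real.log (gpyU #H h)) + 25)) * ((1 + σ₁) / σ₁) ^ #H *
        (R / |T|) := by gcongr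
    _ = _ := by ring

/-! #### Shifting the line `σ = 1` to `σ = σ₁ > 0` ((6.7) → (6.17)) -/

/-- `∫ f(σ₁ + it) dt = ∫ f(1 + it) dt` for `0 < σ₁ ≤ 1`: no poles of `f` in `Re s > 0`.
[cite: GoldstonPintzYildirim2009, Section 6 eq. 6.17] -/
theorem integral_integrand_line_eq {R : ℝ} (hR : 1 ≤ R) {H : Finset ℕ} (hH : H.Nonempty)
    {h : ℕ} (hh : ∀ x ∈ H, x ≤ h) {σ₁ : ℝ} (hσ₁ : 0 < σ₁) (hσ₁1 : σ₁ ≤ 1) :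
    ∫ t : ℝ, GH H (σ₁ + t * I) / riemannZeta (1 + (σ₁ + t * I)) ^ #H *
        perronPow R #H (σ₁ + t * I) =
      ∫ t : ℝ, GH H ((1 : ℝ) + t * I) / riemannZeta (1 + ((1 : ℝ) + t * I)) ^ #H *
        perronPow R #H ((1 : ℝ) + t * I) := by
  have hR0 : 0 < R := by linarith
  refine Literature.NumberTheory.LFunctions.MertensBoundRH.integral_vertical_eq_of_tendsto
    (fun z : ℂ => GH H z / riemannZeta (1 + z) ^ #H * perronPow R #H z) hσ₁1
    (differentiableOn_integrand_strip hR0 hH hσ₁)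
    (integrable_integrand_vertical hR0 hH hh hσ₁)
    (integrable_integrand_vertical hR0 hH hh one_pos) ?_
  refine Literature.Analysis.Complex.VLI.decay_of_norm_le_div
    (F := fun z : ℂ => GH H z / riemannZeta (1 + z) ^ #H * perronPow R #H z) (a := σ₁) (b := 1)
    (C := Real.exp (#H * (4 * Real.log (Real.log (gpyU #H h)) + 25)) * ((1 + σ₁) / σ₁) ^ #H * R)
    (R := 1) ?_
  intro σ hσ T hT
  exact norm_integrand_le_div hR hH hh hσ₁ σ hσ T hT

/-! #### The rectangle `[−σ₀, σ₁] × [−T, T]` and the pole at `s = 0` -/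

/-- `g(z) = G_H(z) R^z W(z)^{−k}` is differentiable on a closed rectangle in `Re z > −1/2` on which
`W(z) = riemannZeta₁(1+z)` does not vanish. [folklore] -/
theorem differentiableOn_residueNumerator {R : ℝ} (hR : 0 < R) {H : Finset ℕ} (hH : H.Nonempty) {a b c d : ℝ}
    (ha : -1 / 2 < a) (hW : ∀ z ∈ Icc a b ×ℂ Icc c d, riemannZeta₁ (1 + z) ≠ 0) :
    DifferentiableOn ℂ (fun z : ℂ => GH H z * (R : ℂ) ^ z / riemannZeta₁ (1 + z) ^ #H)
      (Icc a b ×ℂ Icc c d) := by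
  intro z hz
  have hzre : a ≤ z.re := (mem_reProdIm.1 hz).1.1
  have hG : DifferentiableAt ℂ (GH H) z :=
    (differentiableOn_GH hH).differentiableAt
      ((isOpen_lt continuous_const Complex.continuous_re).mem_nhds
        (show -1 / 2 < z.re by linarith))
  have hcpow : DifferentiableAt ℂ (fun z : ℂ => (R : ℂ) ^ z) z :=
    differentiableAt_id.const_cpow (Or.inl (by exact_mod_cast hR.ne'))
  have hWd : DifferentiableAt ℂ (fun z : ℂ => riemannZeta₁ (1 + z) ^ #H) z :=
    (differentiable_riemannZeta₁_one_add z).pow _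
  exact ((hG.mul hcpow).div hWd (pow_ne_zero _ (hW z hz))).differentiableWithinAt

/-- `g(z)/(z − 0) = f(z)` for `z ≠ 0`. [folklore] -/
theorem residueNumerator_div_eq (R : ℝ) (H : Finset ℕ) {z : ℂ} (hz : z ≠ 0) :
    GH H z * (R : ℂ) ^ z / riemannZeta₁ (1 + z) ^ #H / (z - 0) =
      GH H z / riemannZeta (1 + z) ^ #H * perronPow R #H z := by
  rw [sub_zero, riemannZeta₁_one_add hz, mul_pow, Literature.Analysis.Complex.perronPow, pow_succ]
  ring

/-- `g(0) = 𝔖(H)`. [cite: GoldstonPintzYildirim2009, Section 6 eq. 6.10] -/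
theorem residueNumerator_zero (R : ℝ) (H : Finset ℕ) :
    GH H 0 * (R : ℂ) ^ (0 : ℂ) / riemannZeta₁ (1 + 0) ^ #H = (singularSeriesNat H : ℂ) := by
  rw [GH_zero, cpow_zero, add_zero, riemannZeta₁_one, one_pow, mul_one, div_one]

/-- In the rectangle `−c̄/log(T+3) ≤ Re z`, `|Im z| ≤ T`: `W(z) ≠ 0`, and for `z ≠ 0`,
`|ζ(1+z)⁻¹| ≤ C log(T + 3)`. [cite: GoldstonPintzYildirim2009, Section 5 eq. 5.4] -/
theorem zfr_rect {cbar C : ℝ}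
    (hP : ∀ s : ℂ, s ≠ 1 → 1 - 4 * cbar / Real.log (|s.im| + 3) ≤ s.re →
      riemannZeta s ≠ 0 ∧ ‖(riemannZeta s)⁻¹‖ ≤ C * Real.log (|s.im| + 3))
    (hc : 0 ≤ cbar) (hC : 0 ≤ C) {T : ℝ}
    {z : ℂ} (hre : -(cbar / Real.log (T + 3)) ≤ z.re) (him : |z.im| ≤ T) :
    riemannZeta₁ (1 + z) ≠ 0 ∧
      (z ≠ 0 → ‖(riemannZeta (1 + z))⁻¹‖ ≤ C * Real.log (T + 3)) := by
  by_cases hz : z = 0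
  · subst hz; simp [riemannZeta₁_one]
  · have h := zfr_one_add hP hz (region_of_rect hc him hre)
    have hlog : Real.log (|z.im| + 3) ≤ Real.log (T + 3) :=
      Real.log_le_log (by positivity) (by linarith)
    refine ⟨?_, fun _ => h.2.trans (mul_le_mul_of_nonneg_left hlog hC)⟩
    rw [riemannZeta₁_one_add hz]
    exact mul_ne_zero hz h.1

/-- **Cauchy's formula on `[−σ₀, σ₁] × [−T, T]`** for `f = g(z)/z`: in the four-term convention,
`∮ f = 2πi 𝔖(H)` (the simple pole of `F(s) R^s s^{−k−1}` at `s = 0`, residue `G_H(0) = 𝔖(H)`).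
[cite: GoldstonPintzYildirim2009, Section 6 eq. 6.18] -/
theorem rect_integral_eq {cbar C : ℝ}
    (hP : ∀ s : ℂ, s ≠ 1 → 1 - 4 * cbar / Real.log (|s.im| + 3) ≤ s.re →
      riemannZeta s ≠ 0 ∧ ‖(riemannZeta s)⁻¹‖ ≤ C * Real.log (|s.im| + 3))
    (hc : 0 ≤ cbar) (hC : 0 ≤ C)
    {R : ℝ} (hR : 0 < R) {H : Finset ℕ} (hH : H.Nonempty) {σ₀ σ₁ T : ℝ} (hσ₀ : 0 < σ₀)
    (hσ₀' : σ₀ < 1 / 2) (hσ₀c : σ₀ ≤ cbar / Real.log (T + 3)) (hσ₁ : 0 < σ₁) (hT : 0 < T) :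
    (∫ x : ℝ in (-σ₀)..σ₁, GH H (x + (-T : ℝ) * I) / riemannZeta (1 + (x + (-T : ℝ) * I)) ^ #H *
        perronPow R #H (x + (-T : ℝ) * I)) -
      (∫ x : ℝ in (-σ₀)..σ₁, GH H (x + T * I) / riemannZeta (1 + (x + T * I)) ^ #H *
        perronPow R #H (x + T * I)) +
      I * (∫ y : ℝ in (-T)..T, GH H (σ₁ + y * I) / riemannZeta (1 + (σ₁ + y * I)) ^ #H *
        perronPow R #H (σ₁ + y * I)) -
      I * (∫ y : ℝ in (-T)..T, GH H ((-σ₀ : ℝ) + y * I) /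
        riemannZeta (1 + ((-σ₀ : ℝ) + y * I)) ^ #H * perronPow R #H ((-σ₀ : ℝ) + y * I)) =
      2 * Real.pi * I * (singularSeriesNat H : ℂ) := by
  have hW : ∀ z ∈ Icc (-σ₀) σ₁ ×ℂ Icc (-T) T, riemannZeta₁ (1 + z) ≠ 0 := by
    intro z hz
    have hz' := mem_reProdIm.1 hz
    refine (zfr_rect hP hc hC (z := z) ?_ (abs_le.2 ⟨hz'.2.1, hz'.2.2⟩)).1
    linarith [hz'.1.1]
  have hmain := Literature.Analysis.Complex.integral_boundary_rect_div_sub_eq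
    (f := fun z : ℂ => GH H z * (R : ℂ) ^ z / riemannZeta₁ (1 + z) ^ #H) 0
    (a := -σ₀) (b := σ₁) (c := -T) (d := T) (by simp; exact hσ₀) (by simpa using hσ₁)
    (by simp; exact hT) (by simpa using hT) (differentiableOn_residueNumerator hR hH (by linarith) hW)
  rw [residueNumerator_zero] at hmain
  have e1 : ∀ (y : ℝ), y ≠ 0 → ∀ x : ℝ, ((x : ℂ) + y * I) ≠ 0 := fun y hy x h0 => by
    have := congrArg Complex.im h0; simp at this; exact hy this
  have e2 : ∀ (x : ℝ), x ≠ 0 → ∀ y : ℝ, ((x : ℂ) + y * I) ≠ 0 := fun x hx y h0 => by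
    have := congrArg Complex.re h0; simp at this; exact hx this
  have hb : (∫ x : ℝ in (-σ₀)..σ₁, GH H (x + (-T : ℝ) * I) * (R : ℂ) ^ ((x : ℂ) + (-T : ℝ) * I) /
      riemannZeta₁ (1 + (x + (-T : ℝ) * I)) ^ #H / ((x : ℂ) + (-T : ℝ) * I - 0)) =
      ∫ x : ℝ in (-σ₀)..σ₁, GH H (x + (-T : ℝ) * I) / riemannZeta (1 + (x + (-T : ℝ) * I)) ^ #H *
        perronPow R #H (x + (-T : ℝ) * I) :=
    intervalIntegral.integral_congr fun x _ => residueNumerator_div_eq R H (e1 (-T) (by linarith) x)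
  have ht : (∫ x : ℝ in (-σ₀)..σ₁, GH H (x + T * I) * (R : ℂ) ^ ((x : ℂ) + T * I) /
      riemannZeta₁ (1 + (x + T * I)) ^ #H / ((x : ℂ) + T * I - 0)) =
      ∫ x : ℝ in (-σ₀)..σ₁, GH H (x + T * I) / riemannZeta (1 + (x + T * I)) ^ #H *
        perronPow R #H (x + T * I) :=
    intervalIntegral.integral_congr fun x _ => residueNumerator_div_eq R H (e1 T hT.ne' x)
  have hr : (∫ y : ℝ in (-T)..T, GH H (σ₁ + y * I) * (R : ℂ) ^ ((σ₁ : ℂ) + y * I) /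
      riemannZeta₁ (1 + (σ₁ + y * I)) ^ #H / ((σ₁ : ℂ) + y * I - 0)) =
      ∫ y : ℝ in (-T)..T, GH H (σ₁ + y * I) / riemannZeta (1 + (σ₁ + y * I)) ^ #H *
        perronPow R #H (σ₁ + y * I) :=
    intervalIntegral.integral_congr fun y _ => residueNumerator_div_eq R H (e2 σ₁ hσ₁.ne' y)
  have hl : (∫ y : ℝ in (-T)..T, GH H ((-σ₀ : ℝ) + y * I) * (R : ℂ) ^ (((-σ₀ : ℝ) : ℂ) + y * I) /
      riemannZeta₁ (1 + ((-σ₀ : ℝ) + y * I)) ^ #H / (((-σ₀ : ℝ) : ℂ) + y * I - 0)) =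
      ∫ y : ℝ in (-T)..T, GH H ((-σ₀ : ℝ) + y * I) / riemannZeta (1 + ((-σ₀ : ℝ) + y * I)) ^ #H *
        perronPow R #H ((-σ₀ : ℝ) + y * I) :=
    intervalIntegral.integral_congr fun y _ => residueNumerator_div_eq R H (e2 (-σ₀) (by linarith) y)
  rw [hb, ht, hr, hl] at hmain
  exact hmain

/-! #### Numerical facts about the parameters `L ≥ 4`, `q = √L`, `T = e^q − 3` -/

/-- `e² > 7`. [folklore] -/
theorem seven_lt_exp_two : (7 : ℝ) < Real.exp 2 := by
  have h := Real.exp_one_gt_d9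
  have : Real.exp 2 = Real.exp 1 * Real.exp 1 := by rw [← Real.exp_add]; norm_num
  rw [this]; nlinarith

/-- For `q ≥ 2`: `T = e^q − 3 > 4`, and `1/T ≤ 2 e^{−q}`. [folklore] -/
theorem four_lt_exp_sub_three {q : ℝ} (hq : 2 ≤ q) :
    4 < Real.exp q - 3 ∧ 1 / (Real.exp q - 3) ≤ 2 * Real.exp (-q) := by
  have h2 : Real.exp 2 ≤ Real.exp q := Real.exp_le_exp.2 hq
  have h7 := seven_lt_exp_two
  refine ⟨by linarith, ?_⟩
  rw [Real.exp_neg, div_le_iff₀ (by linarith)]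
  rw [show 2 * (Real.exp q)⁻¹ * (Real.exp q - 3) = 2 - 6 * (Real.exp q)⁻¹ by
    field_simp; ring]
  have : 6 * (Real.exp q)⁻¹ ≤ 1 := by
    rw [← div_eq_mul_inv, div_le_one (Real.exp_pos q)]; linarith
  linarith

/-! #### GPY (6.18), explicit form -/

/-- **GPY (6.17)–(6.18), explicit.** With the zero-free-region package `(c̄, C)` of (5.3)–(5.4),
for `R ≥ e⁴`, `H ≠ ∅` (`k = |H|`), `H ⊆ [0, h]`, `U = U(k, h)` of (6.14) and `L = log R`:
`|T_R(N; H) − 𝔖(H)| ≤ 6 exp(k U^{c̄/√L} (4 log log U + 25)) ((2 + C/c̄ + C) L)^k e^{−c̄ √L}`.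
The contour of (6.17)–(6.18) is replaced by the polygon `σ = 1/L` (`|t| ≥ T`),
`[−c̄/√L, 1/L] × {±T}`, `σ = −c̄/√L` (`|t| ≤ T`) with `T = e^{√L} − 3` (so that the rectangle lies in
the region (5.2) and `R^{−c̄/√L} = e^{−c̄√L}`); the pole at `s = 0` is simple with residue
`G_H(0) = 𝔖(H)` ((6.9)–(6.10)). [cite: GoldstonPintzYildirim2009, Section 6 eq. 6.18] -/
theorem abs_mainTR_sub_singularSeries_le {cbar C : ℝ}
    (hP : ∀ s : ℂ, s ≠ 1 → 1 - 4 * cbar / Real.log (|s.im| + 3) ≤ s.re →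
      riemannZeta s ≠ 0 ∧ ‖(riemannZeta s)⁻¹‖ ≤ C * Real.log (|s.im| + 3))
    (hc0 : 0 < cbar)
    (hc1 : cbar ≤ 1 / 100) (hC : 0 < C) {R : ℝ} (hR : Real.exp 4 ≤ R) {H : Finset ℕ}
    (hH : H.Nonempty) {h : ℕ} (hh : ∀ x ∈ H, x ≤ h) :
    |mainTR R H 0 - singularSeriesNat H| ≤
      6 * Real.exp (#H * gpyU #H h ^ (cbar / Real.sqrt (Real.log R)) *
          (4 * Real.log (Real.log (gpyU #H h)) + 25)) *
        ((2 + C / cbar + C) * Real.log R) ^ #H * Real.exp (-(cbar * Real.sqrt (Real.log R))) := by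
  /- parameters -/
  have hk1 : 1 ≤ #H := hH.card_pos
  have hR0 : 0 < R := (Real.exp_pos 4).trans_le hR
  have hR1 : 1 ≤ R := le_trans (by have := Real.add_one_le_exp (4 : ℝ); linarith) hR
  set L : ℝ := Real.log R with hL
  have hL4 : 4 ≤ L := by
    have := Real.log_le_log (Real.exp_pos 4) hR; rwa [Real.log_exp] at this
  have hL0 : 0 < L := by linarith
  have hL1 : 1 ≤ L := by linarith
  set q : ℝ := Real.sqrt L with hq
  have hq2 : 2 ≤ q := by
    rw [hq, show (2 : ℝ) = Real.sqrt 4 by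
      rw [show (4 : ℝ) = 2 ^ 2 by norm_num, Real.sqrt_sq (by norm_num)]]
    exact Real.sqrt_le_sqrt hL4
  have hq0 : 0 < q := by linarith
  have hqq : q * q = L := Real.mul_self_sqrt hL0.le
  have hqL : q ≤ L := by
    calc q = q * 1 := (mul_one q).symm
      _ ≤ q * q := mul_le_mul_of_nonneg_left (by linarith) hq0.le
      _ = L := hqq
  have hLq : L / q = q := by rw [← hqq]; field_simp
  obtain ⟨hT4, hTinv⟩ := four_lt_exp_sub_three hq2
  set T : ℝ := Real.exp q - 3 with hT
  have hT0 : 0 < T := by linarith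
  have hT1 : 1 ≤ T := by linarith
  have hT3 : T + 3 = Real.exp q := by rw [hT]; ring
  have hlogT : Real.log (T + 3) = q := by rw [hT3, Real.log_exp]
  set σ₀ : ℝ := cbar / q with hσ₀
  have hσ₀0 : 0 < σ₀ := div_pos hc0 hq0
  have hσ₀le : σ₀ ≤ 1 / 200 := by
    rw [hσ₀, div_le_iff₀ hq0]; linarith
  have hσ₀c : σ₀ ≤ cbar / Real.log (T + 3) := by rw [hlogT]
  set σ₁ : ℝ := 1 / L with hσ₁
  have hσ₁0 : 0 < σ₁ := by positivity
  have hσ₁le : σ₁ ≤ 1 / 4 := by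
    rw [hσ₁, div_le_div_iff₀ hL0 (by norm_num)]; linarith
  have hσ₁1 : σ₁ ≤ 1 := by linarith
  -- powers of `R`
  have hRσ₁ : R ^ σ₁ = Real.exp 1 := by
    rw [Real.rpow_def_of_pos hR0, ← hL, hσ₁, mul_one_div_cancel hL0.ne']
  have hRσ₀ : R ^ (-σ₀) = Real.exp (-(cbar * q)) := by
    rw [Real.rpow_def_of_pos hR0, ← hL, hσ₀]
    congr 1
    rw [mul_neg, mul_div_assoc', mul_comm L cbar, mul_div_assoc, hLq]
  have hRx : ∀ x : ℝ, x ≤ σ₁ → R ^ x ≤ Real.exp 1 := fun x hx => by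
    rw [← hRσ₁]; exact Real.rpow_le_rpow_of_exponent_le hR1 hx
  -- the bounds `B₀ ≤ B` for `G_H`
  set U : ℝ := gpyU #H h with hU
  set B₀ : ℝ := Real.exp (#H * (4 * Real.log (Real.log U) + 25)) with hB₀
  set B : ℝ := Real.exp (#H * U ^ σ₀ * (4 * Real.log (Real.log U) + 25)) with hB
  have hB₀B : B₀ ≤ B := by
    have := exp_gpyU_bound_mono #H h hσ₀0.le
    rwa [Real.rpow_zero, mul_one] at this
  have hB0 : 0 < B := Real.exp_pos _
  have hB₀0 : 0 < B₀ := Real.exp_pos _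
  have hGH_B : ∀ z : ℂ, -σ₀ ≤ z.re → ‖GH H z‖ ≤ B := by
    intro z hz
    refine (norm_GH_le hH hh (by linarith : -1 / 4 ≤ z.re)).trans ?_
    exact exp_gpyU_bound_mono #H h (max_le (by linarith) hσ₀0.le)
  /- Step 1: `T_R` as the line integral on `σ = 1` (6.7), then on `σ = σ₁` -/
  have hpt : ∀ t : ℝ, (∑' d : ℕ, (μ d : ℂ) * (nu H d : ℂ) / (d : ℂ) ^ (1 + (((1 : ℝ) : ℂ) + t * I))) *
      perronPow R (#H + 0) (((1 : ℝ) : ℂ) + t * I) =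
      GH H ((1 : ℝ) + t * I) / riemannZeta (1 + ((1 : ℝ) + t * I)) ^ #H *
        perronPow R #H ((1 : ℝ) + t * I) := by
    intro t
    have h1 := FDir_eq_GH_div hH (s := ((1 : ℝ) : ℂ) + t * I) (by norm_num)
    rw [← h1]; rfl
  have hM : (mainTR R H 0 : ℂ) = (1 / (2 * Real.pi) : ℂ) *
      ∫ t : ℝ, GH H ((1 : ℝ) + t * I) / riemannZeta (1 + ((1 : ℝ) + t * I)) ^ #H *
        perronPow R #H ((1 : ℝ) + t * I) := by
    rw [mainTR_eq_integral hR0 hH 0]; simp_rw [hpt]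
  rw [← integral_integrand_line_eq hR1 hH hh hσ₁0 hσ₁1] at hM
  /- Step 2: the rectangle identity -/
  have hrect := rect_integral_eq hP hc0.le hC.le hR0 hH hσ₀0 (by linarith) hσ₀c hσ₁0 hT0
  set Sline := ∫ t : ℝ, GH H (σ₁ + t * I) / riemannZeta (1 + (σ₁ + t * I)) ^ #H *
    perronPow R #H (σ₁ + t * I) with hSline
  set right := ∫ y : ℝ in (-T)..T, GH H (σ₁ + y * I) / riemannZeta (1 + (σ₁ + y * I)) ^ #H *
    perronPow R #H (σ₁ + y * I) with hright
  set left := ∫ y : ℝ in (-T)..T, GH H ((-σ₀ : ℝ) + y * I) /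
    riemannZeta (1 + ((-σ₀ : ℝ) + y * I)) ^ #H * perronPow R #H ((-σ₀ : ℝ) + y * I) with hleft
  set bot := ∫ x : ℝ in (-σ₀)..σ₁, GH H (x + (-T : ℝ) * I) /
    riemannZeta (1 + (x + (-T : ℝ) * I)) ^ #H * perronPow R #H (x + (-T : ℝ) * I) with hbot
  set top := ∫ x : ℝ in (-σ₀)..σ₁, GH H (x + T * I) / riemannZeta (1 + (x + T * I)) ^ #H *
    perronPow R #H (x + T * I) with htop
  /- Step 3a: tails on `σ = σ₁` -/
  have htails : ‖Sline - right‖ ≤ 2 * ((B₀ * (2 * L) ^ #H * Real.exp 1) / T) := by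
    refine norm_integral_sub_intervalIntegral_le (integrable_integrand_vertical hR0 hH hh hσ₁0) hT0
      fun t ht => ?_
    have hT1t : 1 ≤ |t| := hT1.trans ht
    have ht0 : t ≠ 0 := by intro h0; rw [h0, abs_zero] at hT1t; linarith
    refine (norm_integrand_le_of_re_pos R hH hh hσ₁0 t).trans ?_
    have hP1 : ‖perronPow R #H (σ₁ + t * I)‖ ≤ Real.exp 1 / t ^ 2 := by
      refine (Literature.Analysis.Complex.norm_perronPow_le_horizontal hR0 #H σ₁ ht0).trans ?_
      rw [hRσ₁]
      refine div_le_div_of_nonneg_left (Real.exp_pos 1).le (by positivity) ?_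
      calc t ^ 2 = |t| ^ 2 := (sq_abs t).symm
        _ ≤ |t| ^ (#H + 1) := pow_le_pow_right₀ hT1t (by omega)
    have hratio : (1 + σ₁) / σ₁ ≤ 2 * L := by
      rw [div_le_iff₀ hσ₁0]
      have : 2 * L * σ₁ = 2 := by rw [hσ₁]; field_simp
      rw [this]; linarith
    have hratio0 : 0 ≤ (1 + σ₁) / σ₁ := by positivity
    calc B₀ * ((1 + σ₁) / σ₁) ^ #H * ‖perronPow R #H (σ₁ + t * I)‖
        ≤ B₀ * (2 * L) ^ #H * (Real.exp 1 / t ^ 2) := by gcongr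
      _ = B₀ * (2 * L) ^ #H * Real.exp 1 / t ^ 2 := by ring
  /- Step 3b: the left edge `σ = −σ₀` -/
  have hleftb : ‖left‖ ≤ Real.pi * B * (C * L / cbar) ^ #H * Real.exp (-(cbar * q)) := by
    set K : ℝ := B * (C * q) ^ #H * Real.exp (-(cbar * q)) * (σ₀ ^ (#H - 1))⁻¹ with hK
    have hK0 : 0 ≤ K := by positivity
    have hpt' : ∀ y : ℝ, y ∈ Ioc (-T) T →
        ‖GH H ((-σ₀ : ℝ) + y * I) / riemannZeta (1 + ((-σ₀ : ℝ) + y * I)) ^ #H *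
          perronPow R #H ((-σ₀ : ℝ) + y * I)‖ ≤ K * (σ₀ ^ 2 + y ^ 2)⁻¹ := by
      intro y hy
      have hz0 : ((-σ₀ : ℝ) : ℂ) + y * I ≠ 0 := fun h0 => by
        have := congrArg Complex.re h0; simp at this; linarith
      have hzre : (((-σ₀ : ℝ) : ℂ) + y * I).re = -σ₀ := by simp
      have hzim : (((-σ₀ : ℝ) : ℂ) + y * I).im = y := by simp
      have hG := hGH_B (((-σ₀ : ℝ) : ℂ) + y * I) (by rw [hzre])
      have hZ := (zfr_rect hP hc0.le hC.le (T := T) (z := ((-σ₀ : ℝ) : ℂ) + y * I)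
        (by rw [hzre]; linarith) (by rw [hzim]; exact abs_le.2 ⟨hy.1.le, hy.2⟩)).2 hz0
      rw [hlogT] at hZ
      have hPn : ‖perronPow R #H ((-σ₀ : ℝ) + y * I)‖ ≤
          Real.exp (-(cbar * q)) * ((σ₀ ^ (#H - 1))⁻¹ * (σ₀ ^ 2 + y ^ 2)⁻¹) := by
        rw [Literature.Analysis.Complex.norm_perronPow hR0, hRσ₀, div_eq_mul_inv]
        refine mul_le_mul_of_nonneg_left ?_ (Real.exp_pos _).le
        have := inv_norm_pow_le (σ := -σ₀) (by linarith) hk1 y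
        rwa [abs_neg, abs_of_pos hσ₀0, neg_sq] at this
      rw [norm_div_pow_mul]
      calc ‖GH H ((-σ₀ : ℝ) + y * I)‖ * ‖(riemannZeta (1 + ((-σ₀ : ℝ) + y * I)))⁻¹‖ ^ #H *
            ‖perronPow R #H ((-σ₀ : ℝ) + y * I)‖
          ≤ B * (C * q) ^ #H *
            (Real.exp (-(cbar * q)) * ((σ₀ ^ (#H - 1))⁻¹ * (σ₀ ^ 2 + y ^ 2)⁻¹)) := by
            gcongr
        _ = K * (σ₀ ^ 2 + y ^ 2)⁻¹ := by rw [hK]; ring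
    have hint : ‖left‖ ≤ ∫ y in (-T)..T, K * (σ₀ ^ 2 + y ^ 2)⁻¹ :=
      intervalIntegral.norm_integral_le_of_norm_le (by linarith)
        (ae_of_all _ fun y hy => hpt' y hy)
        (((integrable_inv_sq_add_sq hσ₀0).const_mul K).intervalIntegrable)
    have hwhole : ∫ y in (-T)..T, K * (σ₀ ^ 2 + y ^ 2)⁻¹ ≤ K * (Real.pi / σ₀) := by
      rw [intervalIntegral.integral_of_le (by linarith), ← integral_inv_sq_add_sq hσ₀0,
        ← integral_const_mul]
      exact setIntegral_le_integral ((integrable_inv_sq_add_sq hσ₀0).const_mul K)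
        (ae_of_all _ fun y => by positivity)
    refine hint.trans (hwhole.trans (le_of_eq ?_))
    -- `K π/σ₀ = π B (C L/cbar)^k e^{-cbar q}`
    have hσpow : (σ₀ ^ (#H - 1))⁻¹ * (Real.pi / σ₀) = Real.pi / σ₀ ^ #H := by
      obtain ⟨j, hj⟩ : ∃ j, #H = j + 1 := ⟨#H - 1, by omega⟩
      rw [hj, add_tsub_cancel_right, pow_succ]
      field_simp
    have hCL : C * L / cbar = C * q / σ₀ := by
      rw [hσ₀]; field_simp; rw [← hqq]; ring
    have hratio' : (C * q) ^ #H / σ₀ ^ #H = (C * L / cbar) ^ #H := by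
      rw [← div_pow, ← hCL]
    calc K * (Real.pi / σ₀)
        = B * (C * q) ^ #H * Real.exp (-(cbar * q)) * ((σ₀ ^ (#H - 1))⁻¹ * (Real.pi / σ₀)) := by
          rw [hK]; ring
      _ = B * (C * q) ^ #H * Real.exp (-(cbar * q)) * (Real.pi / σ₀ ^ #H) := by rw [hσpow]
      _ = Real.pi * B * ((C * q) ^ #H / σ₀ ^ #H) * Real.exp (-(cbar * q)) := by ring
      _ = Real.pi * B * (C * L / cbar) ^ #H * Real.exp (-(cbar * q)) := by rw [hratio']
  /- Step 3c: the horizontal edges `t = ±T` -/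
  have hTinv' : 1 / T ≤ 2 * Real.exp (-q) := hTinv
  have hedge : ∀ y : ℝ, |y| = T →
      ‖∫ x : ℝ in (-σ₀)..σ₁, GH H (x + y * I) / riemannZeta (1 + (x + y * I)) ^ #H *
        perronPow R #H (x + y * I)‖ ≤ B * (C * q) ^ #H * (2 * Real.exp 1 * Real.exp (-q)) := by
    intro y hy
    have hy0 : y ≠ 0 := by intro h0; rw [h0, abs_zero] at hy; linarith
    have hbound : ∀ x ∈ Set.uIoc (-σ₀) σ₁, ‖GH H (x + y * I) / riemannZeta (1 + (x + y * I)) ^ #H *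
        perronPow R #H (x + y * I)‖ ≤ B * (C * q) ^ #H * (2 * Real.exp 1 * Real.exp (-q)) := by
      intro x hx
      rw [Set.uIoc_of_le (by linarith)] at hx
      have hz0 : ((x : ℝ) : ℂ) + y * I ≠ 0 := fun h0 => by
        have := congrArg Complex.im h0; simp at this; exact hy0 this
      have hzre : (((x : ℝ) : ℂ) + y * I).re = x := by simp
      have hzim : (((x : ℝ) : ℂ) + y * I).im = y := by simp
      have hG := hGH_B (((x : ℝ) : ℂ) + y * I) (by rw [hzre]; exact hx.1.le)
      have hZ := (zfr_rect hP hc0.le hC.le (T := T) (z := ((x : ℝ) : ℂ) + y * I)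
        (by rw [hzre]; linarith [hx.1]) (by rw [hzim, hy])).2 hz0
      rw [hlogT] at hZ
      have hPn : ‖perronPow R #H (x + y * I)‖ ≤ 2 * Real.exp 1 * Real.exp (-q) := by
        refine (Literature.Analysis.Complex.norm_perronPow_le_horizontal hR0 #H x hy0).trans ?_
        rw [hy]
        have h1 : R ^ x ≤ Real.exp 1 := hRx x hx.2
        have h2 : T ≤ T ^ (#H + 1) := by
          calc T = T ^ 1 := (pow_one T).symm
            _ ≤ T ^ (#H + 1) := pow_le_pow_right₀ hT1 (by omega)
        calc R ^ x / T ^ (#H + 1) ≤ Real.exp 1 / T := div_le_div₀ (Real.exp_pos 1).le h1 hT0 h2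
          _ = Real.exp 1 * (1 / T) := by ring
          _ ≤ Real.exp 1 * (2 * Real.exp (-q)) :=
              mul_le_mul_of_nonneg_left hTinv' (Real.exp_pos 1).le
          _ = 2 * Real.exp 1 * Real.exp (-q) := by ring
      rw [norm_div_pow_mul]
      gcongr
    have := intervalIntegral.norm_integral_le_of_norm_le_const hbound
    refine this.trans ?_
    have hlen : |σ₁ - -σ₀| ≤ 1 := by rw [abs_of_pos (by linarith)]; linarith
    have h0 : 0 ≤ B * (C * q) ^ #H * (2 * Real.exp 1 * Real.exp (-q)) := by positivity
    calc B * (C * q) ^ #H * (2 * Real.exp 1 * Real.exp (-q)) * |σ₁ - -σ₀|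
        ≤ B * (C * q) ^ #H * (2 * Real.exp 1 * Real.exp (-q)) * 1 :=
          mul_le_mul_of_nonneg_left hlen h0
      _ = _ := mul_one _
  have htopb : ‖top‖ ≤ B * (C * q) ^ #H * (2 * Real.exp 1 * Real.exp (-q)) :=
    hedge T (abs_of_pos hT0)
  have hbotb : ‖bot‖ ≤ B * (C * q) ^ #H * (2 * Real.exp 1 * Real.exp (-q)) :=
    hedge (-T) (by rw [abs_neg, abs_of_pos hT0])
  /- Step 4: the identity `T_R − 𝔖 = (1/2π)((S − right) + left − I top + I bot)` -/
  have hright_eq : right = 2 * Real.pi * (singularSeriesNat H : ℂ) + left - I * top + I * bot := by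
    linear_combination (-I) * hrect + (right - left - 2 * Real.pi * (singularSeriesNat H : ℂ)) *
      Complex.I_mul_I
  have hπ : (2 * Real.pi : ℂ) ≠ 0 := by exact_mod_cast (mul_pos two_pos Real.pi_pos).ne'
  have hkey : (mainTR R H 0 : ℂ) - (singularSeriesNat H : ℂ) =
      (1 / (2 * Real.pi) : ℂ) * ((Sline - right) + left - I * top + I * bot) := by
    rw [hM, hright_eq]; field_simp; ring
  have hnorm : |mainTR R H 0 - singularSeriesNat H| ≤
      1 / (2 * Real.pi) * (‖Sline - right‖ + ‖left‖ + ‖top‖ + ‖bot‖) := by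
    have e1 : |mainTR R H 0 - singularSeriesNat H| =
        ‖(mainTR R H 0 : ℂ) - (singularSeriesNat H : ℂ)‖ := by
      rw [← Complex.ofReal_sub, Complex.norm_real, Real.norm_eq_abs]
    rw [e1, hkey, norm_mul]
    have e2 : ‖(1 / (2 * Real.pi) : ℂ)‖ = 1 / (2 * Real.pi) := by
      rw [show (1 / (2 * Real.pi) : ℂ) = ((1 / (2 * Real.pi) : ℝ) : ℂ) by push_cast; ring,
        Complex.norm_real, Real.norm_eq_abs, abs_of_pos (by positivity)]
    rw [e2]
    refine mul_le_mul_of_nonneg_left ?_ (by positivity)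
    calc ‖Sline - right + left - I * top + I * bot‖
        ≤ ‖Sline - right + left - I * top‖ + ‖I * bot‖ := norm_add_le _ _
      _ ≤ ‖Sline - right + left‖ + ‖I * top‖ + ‖I * bot‖ :=
          add_le_add (norm_sub_le _ _) le_rfl
      _ ≤ ‖Sline - right‖ + ‖left‖ + ‖I * top‖ + ‖I * bot‖ :=
          add_le_add (add_le_add (norm_add_le _ _) le_rfl) le_rfl
      _ = ‖Sline - right‖ + ‖left‖ + ‖top‖ + ‖bot‖ := by
          rw [norm_mul, norm_mul, Complex.norm_I, one_mul, one_mul]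
  /- Step 5: numerics -/
  set E : ℝ := Real.exp (-(cbar * q)) with hE
  have hE0 : 0 ≤ E := (Real.exp_pos _).le
  set Kc : ℝ := 2 + C / cbar + C with hKc
  have hCc0 : 0 ≤ C / cbar := by positivity
  have hexpq : Real.exp (-q) ≤ E := by
    refine Real.exp_le_exp.2 ?_
    have : cbar * q ≤ 1 * q := mul_le_mul_of_nonneg_right (by linarith) hq0.le
    linarith
  have h2K : (2 : ℝ) ^ #H ≤ Kc ^ #H :=
    pow_le_pow_left₀ (by norm_num) (by rw [hKc]; linarith only [hCc0, hC]) _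
  have hCK : (C / cbar) ^ #H ≤ Kc ^ #H :=
    pow_le_pow_left₀ hCc0 (by rw [hKc]; linarith only [hCc0, hC]) _
  have hCK' : C ^ #H ≤ Kc ^ #H :=
    pow_le_pow_left₀ hC.le (by rw [hKc]; linarith only [hCc0, hC]) _
  have hLk : 0 < L ^ #H := by positivity
  have hKk : 0 ≤ Kc ^ #H := le_trans (by positivity) h2K
  have hCKc : C ≤ Kc := by rw [hKc]; linarith only [hCc0, hC]
  have hCq : (C * q) ^ #H ≤ Kc ^ #H * L ^ #H := by
    rw [← mul_pow]
    exact pow_le_pow_left₀ (by positivity) (mul_le_mul hCKc hqL hq0.le (hC.le.trans hCKc)) _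
  set X : ℝ := B * Kc ^ #H * L ^ #H * E with hX
  have hX0 : 0 ≤ X := by positivity
  have t1 : ‖Sline - right‖ ≤ 4 * Real.exp 1 * X := by
    refine htails.trans ?_
    have hBK : B₀ * (2 * L) ^ #H ≤ B * Kc ^ #H * L ^ #H := by
      rw [mul_pow, ← mul_assoc]
      exact mul_le_mul (mul_le_mul hB₀B h2K (by positivity) hB0.le) le_rfl hLk.le (by positivity)
    have h1T : 1 / T ≤ 2 * E := hTinv'.trans (by linarith only [hexpq])
    calc 2 * (B₀ * (2 * L) ^ #H * Real.exp 1 / T)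
        = 2 * Real.exp 1 * (B₀ * (2 * L) ^ #H) * (1 / T) := by ring
      _ ≤ 2 * Real.exp 1 * (B * Kc ^ #H * L ^ #H) * (2 * E) :=
          mul_le_mul (mul_le_mul_of_nonneg_left hBK (by positivity)) h1T (by positivity)
            (by positivity)
      _ = 4 * Real.exp 1 * X := by rw [hX]; ring
  have t2 : ‖left‖ ≤ Real.pi * X := by
    refine hleftb.trans ?_
    rw [show C * L / cbar = C / cbar * L by ring, mul_pow]
    have : B * ((C / cbar) ^ #H * L ^ #H) ≤ B * (Kc ^ #H * L ^ #H) :=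
      mul_le_mul_of_nonneg_left (mul_le_mul_of_nonneg_right hCK hLk.le) hB0.le
    calc Real.pi * B * ((C / cbar) ^ #H * L ^ #H) * Real.exp (-(cbar * q))
        = Real.pi * (B * ((C / cbar) ^ #H * L ^ #H)) * E := by rw [hE]; ring
      _ ≤ Real.pi * (B * (Kc ^ #H * L ^ #H)) * E :=
          mul_le_mul_of_nonneg_right (mul_le_mul_of_nonneg_left this Real.pi_pos.le) hE0
      _ = Real.pi * X := by rw [hX]; ring
  have t3 : B * (C * q) ^ #H * (2 * Real.exp 1 * Real.exp (-q)) ≤ 2 * Real.exp 1 * X := by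
    calc B * (C * q) ^ #H * (2 * Real.exp 1 * Real.exp (-q))
        ≤ B * (Kc ^ #H * L ^ #H) * (2 * Real.exp 1 * E) :=
          mul_le_mul (mul_le_mul_of_nonneg_left hCq hB0.le)
            (mul_le_mul_of_nonneg_left hexpq (by positivity)) (by positivity) (by positivity)
      _ = 2 * Real.exp 1 * X := by rw [hX]; ring
  have he : Real.exp 1 < 2.7182818286 := Real.exp_one_lt_d9
  have hpi3 : (3 : ℝ) < Real.pi := Real.pi_gt_three
  have hpi4 : Real.pi < 3.15 := Real.pi_lt_d2
  have heX : Real.exp 1 * X ≤ 2.7182818286 * X := mul_le_mul_of_nonneg_right he.le hX0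
  have hπX : Real.pi * X ≤ 3.15 * X := mul_le_mul_of_nonneg_right hpi4.le hX0
  have hsum : ‖Sline - right‖ + ‖left‖ + ‖top‖ + ‖bot‖ ≤ 26 * X := by
    have t3a := htopb.trans t3
    have t3b := hbotb.trans t3
    linarith only [t1, t2, t3a, t3b, heX, hπX, hX0]
  calc |mainTR R H 0 - singularSeriesNat H|
      ≤ 1 / (2 * Real.pi) * (‖Sline - right‖ + ‖left‖ + ‖top‖ + ‖bot‖) := hnorm
    _ ≤ 1 / (2 * Real.pi) * (26 * X) := mul_le_mul_of_nonneg_left hsum (by positivity)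
    _ ≤ 6 * X := by
        rw [show 1 / (2 * Real.pi) * (26 * X) = (26 / (2 * Real.pi)) * X by ring]
        refine mul_le_mul_of_nonneg_right ?_ hX0
        rw [div_le_iff₀ (by positivity)]; linarith only [hpi3]
    _ = 6 * B * (Kc * L) ^ #H * E := by rw [hX, mul_pow]; ring

/-! #### GPY (6.18) for fixed `k`: `T_R = 𝔖(H) + O(e^{−c√log R})` -/

/-- `U(k, h) ≤ (16 + 4k² + k²(1 + C₀)) log R` when `h ≤ R^{C₀}`, `log R ≥ 1`.
[cite: GoldstonPintzYildirim2009, Section 6 eq. 6.14] -/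
theorem gpyU_le_mul_log {k h : ℕ} {R C₀ : ℝ} (hR : 1 ≤ R) (hC₀ : 0 ≤ C₀) (hh : (h : ℝ) ≤ R ^ C₀)
    (hL : 1 ≤ Real.log R) :
    gpyU k h ≤ (16 + 4 * (k : ℝ) ^ 2 + (k : ℝ) ^ 2 * (1 + C₀)) * Real.log R := by
  set L := Real.log R with hLdef
  have hk0 : 0 ≤ (k : ℝ) ^ 2 := sq_nonneg _
  have hA0 : 0 ≤ 16 + 4 * (k : ℝ) ^ 2 + (k : ℝ) ^ 2 * (1 + C₀) := by positivity
  have hlog : Real.log (2 * h) ≤ 1 + C₀ * L := by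
    rcases Nat.eq_zero_or_pos h with rfl | hpos
    · simp only [Nat.cast_zero, mul_zero, Real.log_zero]; positivity
    · have h1 : (1 : ℝ) ≤ h := by exact_mod_cast hpos
      rw [Real.log_mul two_ne_zero (by positivity)]
      have hl2 : Real.log 2 ≤ 1 := by have := Real.log_two_lt_d9; linarith
      have hlh : Real.log h ≤ C₀ * L := by
        calc Real.log h ≤ Real.log (R ^ C₀) := Real.log_le_log (by positivity) hh
          _ = C₀ * L := Real.log_rpow (by linarith) C₀
      linarith
  unfold gpyU
  refine max_le (max_le ?_ ?_) ?_
  · nlinarith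
  · nlinarith
  · calc (k : ℝ) ^ 2 * Real.log (2 * h) ≤ (k : ℝ) ^ 2 * (1 + C₀ * L) :=
          mul_le_mul_of_nonneg_left hlog hk0
      _ ≤ (16 + 4 * (k : ℝ) ^ 2 + (k : ℝ) ^ 2 * (1 + C₀)) * L := by nlinarith

/-- **GPY (6.18)** (fixed `k`; the `k`-uniformity (6.1) is not tracked): for every `k ≥ 1` and
`C₀ > 0` there are `c > 0` and `R₀` such that for `R ≥ R₀`, every `k`-element `H ⊆ [0, h]` with
`h ≤ R^{C₀}` satisfies `|T_R(N; H) − 𝔖(H)| ≤ e^{−c√log R}` (`T_R = mainTR R H 0`, `ℓ = 0`).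
[cite: GoldstonPintzYildirim2009, Section 6 eq. 6.18] -/
theorem exists_abs_mainTR_sub_singularSeries_le {k : ℕ} (hk : 1 ≤ k) {C₀ : ℝ} (hC₀ : 0 < C₀) :
    ∃ c : ℝ, 0 < c ∧ ∃ R₀ : ℝ, ∀ R : ℝ, R₀ ≤ R → ∀ (h : ℕ) (H : Finset ℕ), #H = k →
      (∀ x ∈ H, x ≤ h) → (h : ℝ) ≤ R ^ C₀ →
        |mainTR R H 0 - singularSeriesNat H| ≤ Real.exp (-(c * Real.sqrt (Real.log R))) := by
  obtain ⟨cbar, hc0, hc1, C, hC, hP⟩ := Literature.NumberTheory.LFunctions.ZetaClassicalRegion.exists_zeroFreeRegion_bounds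
  have hP' : ∀ s : ℂ, s ≠ 1 → 1 - 4 * cbar / Real.log (|s.im| + 3) ≤ s.re →
      riemannZeta s ≠ 0 ∧ ‖(riemannZeta s)⁻¹‖ ≤ C * Real.log (|s.im| + 3) :=
    fun s hs hσ => ⟨(hP s hs hσ).1, (hP s hs hσ).2.2.1⟩
  set A : ℝ := 16 + 4 * (k : ℝ) ^ 2 + (k : ℝ) ^ 2 * (1 + C₀) with hA
  have hA0 : 0 < A := by positivity
  set Kc : ℝ := 2 + C / cbar + C with hKc
  have hKc0 : 0 < Kc := by positivity
  set C₁ : ℝ := 6 * Real.exp (75 * k) * Kc ^ k with hC₁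
  have hC₁0 : 0 < C₁ := by positivity
  refine ⟨cbar / 2, by positivity, ?_⟩
  -- eventual conditions in `u = √log R`
  have ev1 : ∀ᶠ u : ℝ in atTop, C₁ * u ^ (14 * k) * Real.exp (-(cbar / 2 * u)) ≤ 1 := by
    have hb : 0 < cbar / 2 := by positivity
    have h1 := (Real.tendsto_pow_mul_exp_neg_atTop_nhds_zero (14 * k)).comp
      (tendsto_id.const_mul_atTop hb)
    have h2 := h1.const_mul (C₁ * ((cbar / 2) ^ (14 * k))⁻¹)
    rw [mul_zero] at h2
    filter_upwards [h2.eventually (Iic_mem_nhds (zero_lt_one' ℝ))] with u hu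
    have e : C₁ * u ^ (14 * k) * Real.exp (-(cbar / 2 * u)) = C₁ * ((cbar / 2) ^ (14 * k))⁻¹ *
        ((cbar / 2 * id u) ^ (14 * k) * Real.exp (-(cbar / 2 * id u))) := by
      simp only [id, mul_pow]; field_simp
    rw [e]; exact hu
  have ev2 : ∀ᶠ u : ℝ in atTop, A * u ^ 2 ≤ Real.exp u := by
    have h1 := (Real.tendsto_pow_mul_exp_neg_atTop_nhds_zero 2).const_mul A
    rw [mul_zero] at h1
    filter_upwards [h1.eventually (Iic_mem_nhds (zero_lt_one' ℝ))] with u hu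
    have hu' : A * (u ^ 2 * Real.exp (-u)) ≤ 1 := hu
    have hexp := Real.exp_pos u
    rw [Real.exp_neg, ← mul_assoc] at hu'
    have := mul_le_mul_of_nonneg_right hu' hexp.le
    rwa [inv_mul_cancel_right₀ hexp.ne', one_mul] at this
  have hT : Tendsto (fun R : ℝ => Real.sqrt (Real.log R)) atTop atTop :=
    Real.tendsto_sqrt_atTop.comp Real.tendsto_log_atTop
  obtain ⟨R₀, hR₀⟩ := Filter.eventually_atTop.1 ((eventually_ge_atTop (Real.exp 4)).and
    ((hT.eventually (eventually_ge_atTop 2)).and ((hT.eventually ev1).and (hT.eventually ev2))))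
  refine ⟨R₀, fun R hR h H hHk hh hhR => ?_⟩
  obtain ⟨hR4, hu2, hu1, huA⟩ := hR₀ R hR
  have hH : H.Nonempty := Finset.card_pos.1 (by omega)
  have hR0 : 0 < R := (Real.exp_pos 4).trans_le hR4
  have hR1 : 1 ≤ R := le_trans (by have := Real.add_one_le_exp (4 : ℝ); linarith) hR4
  have main := abs_mainTR_sub_singularSeries_le hP' hc0 hc1 hC hR4 hH hh
  rw [hHk] at main
  set u : ℝ := Real.sqrt (Real.log R) with hu
  set L : ℝ := Real.log R with hL
  have hL4 : 4 ≤ L := by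
    have := Real.log_le_log (Real.exp_pos 4) hR4; rwa [Real.log_exp] at this
  have hL1 : 1 ≤ L := by linarith
  have huu : u * u = L := Real.mul_self_sqrt (by linarith)
  have hu0 : 0 < u := by linarith
  -- `U ≤ A L = A u²`, `log U ≤ u`, `log log U ≤ log u`, `U^{cbar/u} ≤ 3`
  have hUpos := gpyU_pos k h
  have hU : gpyU k h ≤ A * u ^ 2 := by
    have := gpyU_le_mul_log (k := k) hR1 hC₀.le hhR hL1
    rw [sq, huu]; exact this
  have hlogU : Real.log (gpyU k h) ≤ u := by
    calc Real.log (gpyU k h) ≤ Real.log (A * u ^ 2) := Real.log_le_log hUpos hU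
      _ ≤ Real.log (Real.exp u) := Real.log_le_log (by positivity) huA
      _ = u := Real.log_exp u
  have hlogU1 : 1 < Real.log (gpyU k h) := by
    rw [Real.lt_log_iff_exp_lt hUpos]
    exact lt_of_lt_of_le (lt_of_lt_of_le Real.exp_one_lt_d9 (by norm_num)) (sixteen_le_gpyU k h)
  have hll0 : 0 < Real.log (Real.log (gpyU k h)) := Real.log_pos hlogU1
  have hloglogU : Real.log (Real.log (gpyU k h)) ≤ Real.log u :=
    Real.log_le_log (by linarith) hlogU
  have hUpow : gpyU k h ^ (cbar / u) ≤ 3 := by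
    rw [Real.rpow_def_of_pos hUpos]
    calc Real.exp (Real.log (gpyU k h) * (cbar / u)) ≤ Real.exp (u * (cbar / u)) :=
          Real.exp_le_exp.2 (mul_le_mul_of_nonneg_right hlogU (by positivity))
      _ = Real.exp cbar := by rw [mul_div_cancel₀ _ hu0.ne']
      _ ≤ Real.exp 1 := Real.exp_le_exp.2 (by linarith)
      _ ≤ 3 := by have := Real.exp_one_lt_d9; linarith
  -- the bound for `B`
  have hBexp : (k : ℝ) * gpyU k h ^ (cbar / u) * (4 * Real.log (Real.log (gpyU k h)) + 25) ≤
      (k : ℝ) * 3 * (4 * Real.log u + 25) := by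
    have h25 : 0 ≤ 4 * Real.log (Real.log (gpyU k h)) + 25 := by linarith
    exact mul_le_mul (mul_le_mul_of_nonneg_left hUpow (Nat.cast_nonneg k)) (by linarith) h25
      (by positivity)
  have hB : Real.exp ((k : ℝ) * gpyU k h ^ (cbar / u) * (4 * Real.log (Real.log (gpyU k h)) + 25))
      ≤ Real.exp (75 * k) * u ^ (12 * k) := by
    calc Real.exp ((k : ℝ) * gpyU k h ^ (cbar / u) * (4 * Real.log (Real.log (gpyU k h)) + 25))
        ≤ Real.exp ((k : ℝ) * 3 * (4 * Real.log u + 25)) := Real.exp_le_exp.2 hBexp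
      _ = Real.exp (75 * k) * Real.exp (Real.log u * ((12 * k : ℕ) : ℝ)) := by
          rw [← Real.exp_add]; push_cast; ring_nf
      _ = Real.exp (75 * k) * u ^ (12 * k) := by
          rw [← Real.rpow_def_of_pos hu0, Real.rpow_natCast]
  -- assemble
  have hKL : (Kc * L) ^ k = Kc ^ k * u ^ (2 * k) := by
    rw [mul_pow, ← huu, ← sq, ← pow_mul]
  have hfin : 6 * Real.exp ((k : ℝ) * gpyU k h ^ (cbar / u) *
      (4 * Real.log (Real.log (gpyU k h)) + 25)) * (Kc * L) ^ k * Real.exp (-(cbar * u)) ≤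
      Real.exp (-(cbar / 2 * u)) := by
    have hE : Real.exp (-(cbar * u)) = Real.exp (-(cbar / 2 * u)) * Real.exp (-(cbar / 2 * u)) := by
      rw [← Real.exp_add]; ring_nf
    calc 6 * Real.exp ((k : ℝ) * gpyU k h ^ (cbar / u) *
          (4 * Real.log (Real.log (gpyU k h)) + 25)) * (Kc * L) ^ k * Real.exp (-(cbar * u))
        ≤ 6 * (Real.exp (75 * k) * u ^ (12 * k)) * (Kc * L) ^ k * Real.exp (-(cbar * u)) := by
          gcongr
      _ = (C₁ * u ^ (14 * k) * Real.exp (-(cbar / 2 * u))) * Real.exp (-(cbar / 2 * u)) := by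
          rw [hKL, hE, hC₁]; ring_nf
      _ ≤ 1 * Real.exp (-(cbar / 2 * u)) :=
          mul_le_mul_of_nonneg_right hu1 (Real.exp_pos _).le
      _ = Real.exp (-(cbar / 2 * u)) := one_mul _
  exact main.trans hfin

/-! #### GPY (6.2): the special case of Proposition 1 -/

/-- **GPY (6.2)** (special case `ℓ = 0`, one tuple, of Proposition 1; fixed `k`, the
`k`-uniformity (6.1) not tracked): for `k ≥ 1`, `C₀ > 0` there are `c > 0`, `R₀` such that for
`R ≥ R₀`, all `N`, and every `k`-element `H ⊆ [0, h]` with `h ≤ R^{C₀}`,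
`|∑_{n ≤ N} Λ_R(n; H) − 𝔖(H) N| ≤ N e^{−c√log R} + R (2 log R)^{2k}`
(from (6.5), `GoldstonPintzYildirimCounting`, and (6.18)).
[cite: GoldstonPintzYildirim2009, Section 6 eq. 6.2] -/
theorem exists_abs_sum_lambdaR_sub_le {k : ℕ} (hk : 1 ≤ k) {C₀ : ℝ} (hC₀ : 0 < C₀) :
    ∃ c : ℝ, 0 < c ∧ ∃ R₀ : ℝ, ∀ R : ℝ, R₀ ≤ R → ∀ (N h : ℕ) (H : Finset ℕ), #H = k →
      (∀ x ∈ H, x ≤ h) → (h : ℝ) ≤ R ^ C₀ →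
        |∑ n ∈ Icc 1 N, lambdaR R H 0 n - singularSeriesNat H * N| ≤
          N * Real.exp (-(c * Real.sqrt (Real.log R))) + R * (2 * Real.log R) ^ (2 * k) := by
  obtain ⟨c, hc, R₀, hR₀⟩ := exists_abs_mainTR_sub_singularSeries_le hk hC₀
  refine ⟨c, hc, max R₀ (Real.exp k), fun R hR N h H hHk hh hhR => ?_⟩
  have hR₀R : R₀ ≤ R := (le_max_left _ _).trans hR
  have hRk : Real.exp k ≤ R := (le_max_right _ _).trans hR
  have hLk : (k : ℝ) ≤ Real.log R := by
    have := Real.log_le_log (Real.exp_pos _) hRk; rwa [Real.log_exp] at this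
  have hk1 : (1 : ℝ) ≤ k := by exact_mod_cast hk
  have hR1 : 1 ≤ R := by have := Real.add_one_le_exp (k : ℝ); linarith
  have hH : H.Nonempty := Finset.card_pos.1 (by omega)
  have h1 := hR₀ R hR₀R h H hHk hh hhR
  have h2 := abs_sum_lambdaR_sub_le' hR1 hH 0 N
  rw [hHk, Nat.add_zero] at h2
  set L := Real.log R with hL
  have hL0 : 0 ≤ L := by linarith
  have hfac : ((k.factorial : ℕ) : ℝ)⁻¹ ≤ 1 :=
    inv_le_one_of_one_le₀ (by exact_mod_cast Nat.one_le_iff_ne_zero.2 (Nat.factorial_ne_zero k))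
  have h65 : ((k.factorial : ℕ) : ℝ)⁻¹ * L ^ k * (R * ((k : ℝ) + L) ^ k) ≤ R * (2 * L) ^ (2 * k) := by
    have hkL : ((k : ℝ) + L) ^ k ≤ (2 * L) ^ k := pow_le_pow_left₀ (by positivity) (by linarith) k
    have h22 : (2 : ℝ) ^ k ≤ 2 ^ (2 * k) := pow_le_pow_right₀ one_le_two (by omega)
    calc ((k.factorial : ℕ) : ℝ)⁻¹ * L ^ k * (R * ((k : ℝ) + L) ^ k)
        ≤ 1 * L ^ k * (R * (2 * L) ^ k) := by gcongr
      _ = R * (2 ^ k * L ^ (2 * k)) := by rw [mul_pow, pow_mul, sq]; ring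
      _ ≤ R * (2 ^ (2 * k) * L ^ (2 * k)) := by gcongr
      _ = R * (2 * L) ^ (2 * k) := by rw [mul_pow]
  calc |∑ n ∈ Icc 1 N, lambdaR R H 0 n - singularSeriesNat H * N|
      = |(∑ n ∈ Icc 1 N, lambdaR R H 0 n - N * mainTR R H 0) +
          N * (mainTR R H 0 - singularSeriesNat H)| := by ring_nf
    _ ≤ |∑ n ∈ Icc 1 N, lambdaR R H 0 n - N * mainTR R H 0| +
          |(N : ℝ) * (mainTR R H 0 - singularSeriesNat H)| := abs_add_le _ _
    _ = |∑ n ∈ Icc 1 N, lambdaR R H 0 n - N * mainTR R H 0| +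
          N * |mainTR R H 0 - singularSeriesNat H| := by rw [abs_mul, Nat.abs_cast]
    _ ≤ R * (2 * L) ^ (2 * k) + N * Real.exp (-(c * Real.sqrt L)) :=
        add_le_add (h2.trans h65) (mul_le_mul_of_nonneg_left h1 (Nat.cast_nonneg N))
    _ = N * Real.exp (-(c * Real.sqrt L)) + R * (2 * L) ^ (2 * k) := add_comm _ _

end Literature.NumberTheory.Sieve.GPY
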